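import Literature.NumberTheory.BeurlingPrimes.BDTowerPerron
import Literature.NumberTheory.BeurlingPrimes.WellBehavedIntegers
import HarnessLib

/-!
# RiemannHypothesis / RuelleBand — support item `CappedTowerAboveHalf` (a capped off-line tower of Beurling zeta zeros)

Route `RiemannHypothesis/RuelleBand`, item stmt-RiemannHypothesis-24867 (`CappedTowerAboveHalf`, support, rank 9;
negative dictionary lemma of LINE «BEURLING INTEGER TOOTH», rh-idea-2 g3; lane L56), signature verbatim:

  `∀ θ Θ : ℝ, 1 / 2 < θ → θ < Θ → Θ < 1 → ∃ (P : BeurlingPrimes) (a : ℝ) (Z : ℂ → ℂ),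
     0 < a ∧ P.IntErrorLE a θ ∧ P.IsZetaContinuation θ Z ∧ (∀ s : ℂ, Θ < s.re → s.re < 1 → Z s ≠ 0) ∧
     {s : ℂ | Z s = 0 ∧ s.re = Θ}.Infinite`.

CAPPED TOWER ABOVE ONE HALF: for every `1/2 < θ < Θ < 1` there is a discrete Beurling generalized prime system with
`N_P(x) = ax + O(x^θ)` (`a > 0`) whose zeta function continues analytically to `{Re s > θ} ∖ {1}`, has NO zero with
`Θ < Re s < 1`, and has INFINITELY MANY zeros on the line `Re s = Θ`.

PROOF = the sparse-height member of the Broucke–Debruyne 2023 §6 family (Acta Arith. 207, arXiv:2211.08716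
pp. 15–16), formalised in the tree as `Literature/NumberTheory/BeurlingPrimes/BDTower*.lean` (all PROVED, this lane):
objects (`BDTowerTemplate`: `α = 2/(1−Θ)`, `ℓ_k = α(k+8)`, `γ_k = exp 4^k`, `ρ_k = Θ + iγ_k`, DMV kernel `G`),
positivity of the prime density (`BDTowerPositivity`), the template as BV input and the random primes of
Broucke–Vindas Theorem 1.2 (`BDTowerStieltjes.exists_approx`), the entire product `T = ∏ G(ℓ_k(s−ρ_k))G(ℓ_k(s−ρ̄_k))`
with zeros exactly at the factor zeros (`BDTowerProduct`), its growth on vertical strips (`BDTowerGrowth`), the Mellin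
identity `exp ∫ f v^{−s} = s/(s−1)·T` (`BDTowerMellin`), and the fixed-line Perron inversion (`BDTowerPerron`:
`N_P = ax + O(x^θ)`, `a > 0`). The witness is `Z_θ(s) = s/(s−1) · T(s) · e^{Z(s)}` with `Z` the Broucke–Vindas
exponent (`BV.Z`, holomorphic on `Re s > 1/2`): `= ζ_P` on `Re s > 1` (`BV.zeta_eq_exp_mul_exp_Z`), holomorphic on
`{Re s > 1/2} ∖ {1}`, zero-free on `Re s > Θ` off `s = 1` (`towerProd_ne_zero_of_lt_re`), and vanishing at every
`ρ_k` (`towerProd_zero`), an infinite subset of `Re s = Θ` (`zero_injective`).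

No named-fact hypothesis (unconditional, RH-free; the only deep input, BV Theorem 1.2, is proved in the tree).
MEANING (barrier record): the Beurling class "discrete g-primes + `N`-regularity `x^θ` for any `θ > 1/2` +
continuation" carries capped infinite off-line towers at every abscissa `Θ ∈ (θ, 1)`: it is TOWER-BLIND; no
integer "tooth" bounding the number of zeros beyond `1/2 + ε` survives transfer to Beurling systems.
Nothing here bears on the truth of RH; no summit statement is proved by this file.
-/

-- D-0017: a single-problem summit has `RiemannHypothesis.RiemannHypothesis` in every name by design.
set_option linter.dupNamespace false

noncomputable section

namespace Summit.RiemannHypothesis.RiemannHypothesis.Theorems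

open Complex Set MeasureTheory
open Literature.Barriers.RiemannHypothesis Literature.NumberTheory.BeurlingPrimes
open Literature.NumberTheory.BeurlingPrimes.BDTower

/-- **`CappedTowerAboveHalf`** (item stmt-RiemannHypothesis-24867, signature verbatim): for every `1/2 < θ < Θ < 1`
there is a Beurling generalized prime system `P`, `a > 0` and `Z : ℂ → ℂ` with `N_P(x) = ax + O(x^θ)`, `Z` an analytic
continuation of `ζ_P` to `{Re s > θ} ∖ {1}`, `Z ≠ 0` on `Θ < Re s < 1`, and infinitely many zeros of `Z` on `Re s = Θ`.
Broucke–Debruyne 2023 §6 (sparse-height member), via the tree's `BDTower*` files. [cite: BrouckeDebruyne2023, §6] -/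
theorem ruelleBand_cappedTowerAboveHalf :
    ∀ θ Θ : ℝ, 1 / 2 < θ → θ < Θ → Θ < 1 →
      ∃ (P : Literature.Barriers.RiemannHypothesis.BeurlingPrimes) (a : ℝ) (Z : ℂ → ℂ),
        0 < a ∧ P.IntErrorLE a θ ∧ P.IsZetaContinuation θ Z ∧ (∀ s : ℂ, Θ < s.re → s.re < 1 → Z s ≠ 0) ∧
        {s : ℂ | Z s = 0 ∧ s.re = Θ}.Infinite := by
  intro θ Θ hθ hθΘ hΘ1
  have hΘ : 1 / 2 < Θ := lt_trans hθ hθΘ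
  obtain ⟨P, A, hA, -⟩ := exists_approx hΘ hΘ1
  have hfm : Measurable (densCut Θ) := measurable_densCut hΘ1
  have hfb : ∀ v : ℝ, 1 < v → |densCut Θ v| ≤ 2 := abs_densCut_le_two' hΘ hΘ1
  have hgf : ∀ u : ℝ, 1 < u →
      0 ≤ densCut Θ u - densCut Θ u ∧ densCut Θ u - densCut Θ u ≤ 0 * u ^ (-(1 / 2 : ℝ)) := fun u _ ↦ by simp
  obtain ⟨a, ha, hInt⟩ := exists_intErrorLE hΘ hΘ1 hA hθ
  -- the Broucke–Vindas exponent `Z`, kept opaque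
  obtain ⟨Zb, hZd, hZeq⟩ : ∃ Zb : ℂ → ℂ, DifferentiableOn ℂ Zb {s : ℂ | 1 / 2 < s.re} ∧
      ∀ s : ℂ, 1 < s.re → P.zeta s =
        Complex.exp (∫ v in Ioi (1 : ℝ), (densCut Θ v : ℂ) * (v : ℂ) ^ (-s)) * Complex.exp (Zb s) :=
    ⟨BV.Z (densCut Θ) (densCut Θ) P, BV.differentiableOn_Z hA hfm hfb hfm hgf,
      fun s hs ↦ BV.zeta_eq_exp_mul_exp_Z hA hfm hfb hfm hgf hs⟩
  have hTd := differentiable_towerProd hΘ1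
  refine ⟨P, a, fun s ↦ s / (s - 1) * towerProd Θ s * Complex.exp (Zb s), ha, hInt,
    ⟨fun s hs ↦ ?_, fun z hz ↦ ?_⟩, fun s h1 h2 h0 ↦ ?_, ?_⟩
  · -- `Z_θ = ζ_P` on `Re s > 1`
    rw [hZeq s hs, exp_integral_densCut hΘ hΘ1 hs]
  · -- holomorphy on `{θ < Re s} ∖ {1}` (in fact on `{1/2 < Re s} ∖ {1}`)
    have hz12 : 1 / 2 < z.re := lt_trans hθ hz.1
    have hZz : DifferentiableAt ℂ Zb z :=
      hZd.differentiableAt ((isOpen_lt continuous_const Complex.continuous_re).mem_nhds hz12)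
    have h1 : DifferentiableAt ℂ (fun s : ℂ ↦ s / (s - 1)) z :=
      differentiableAt_id.fun_div (differentiableAt_id.sub_const 1) (sub_ne_zero.2 hz.2)
    have h2 : DifferentiableAt ℂ (fun s : ℂ ↦ s / (s - 1) * towerProd Θ s) z := h1.fun_mul (hTd z)
    have h3 : DifferentiableAt ℂ (fun s : ℂ ↦ s / (s - 1) * towerProd Θ s * Complex.exp (Zb s)) z :=
      h2.fun_mul hZz.cexp
    exact h3.differentiableWithinAt
  · -- zero-free on `Θ < Re s < 1`
    have hs0 : s ≠ 0 := fun h ↦ by rw [h, Complex.zero_re] at h1; linarith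
    have hs1 : s - 1 ≠ 0 := sub_ne_zero.2 fun h ↦ by rw [h, Complex.one_re] at h2; linarith
    rcases mul_eq_zero.1 h0 with h | h
    · rcases mul_eq_zero.1 h with h | h
      · exact div_ne_zero hs0 hs1 h
      · exact towerProd_ne_zero_of_lt_re hΘ1 h1 h
    · exact Complex.exp_ne_zero _ h
  · -- infinitely many zeros on `Re s = Θ`: all the `ρ_k`
    refine Set.infinite_of_injective_forall_mem (zero_injective Θ) fun k ↦ ?_
    refine ⟨?_, zero_re Θ k⟩
    show zero Θ k / (zero Θ k - 1) * towerProd Θ (zero Θ k) * Complex.exp (Zb (zero Θ k)) = 0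
    rw [towerProd_zero hΘ1 k, mul_zero, zero_mul]

end Summit.RiemannHypothesis.RiemannHypothesis.Theorems

end
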